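import Literature.MathematicalPhysics.QuantumFieldTheory.Balaban1983to89.B9RWSums346SecondDiffGp

/-!
# `Balaban1983to89.B9Thm37WholeDir` — Theorem 3.7's algebraic schema `B9Thm37Whole.Identities` RE-STATED OVER THE DIRECTION LETTERS
# (`DirOps37`: ∇_{U,μ}, ∇\*_{U,μ} per direction μ): `K(h_□) = Σ_μ P_{□,μ}∇_{U,μ} + C_□` ((3.88) p. 409, [4] (2.39) p. 229) — the v2 clause text
# `Identities₂` of the pin owner's ruling R1′ (N06 certificate rows 18–19, the `Identities` conjunct of `h36`), the per-direction entry transfer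
# `DirSupSq37`, and the STACKING DEVICE by which the v1 Glue faces at `Y′ := X × Dir` ARE the v2 faces

T. Bałaban, *Propagators for lattice gauge theories in a background field*, Commun. Math. Phys. **99** (1985) 389–434
[`Balaban1985BackgroundPropagators`, "B9"], (3.87)–(3.90) pp. 408–409, (3.5)–(3.8) p. 392, (3.23) p. 394, (3.42) p. 397; T. Bałaban, *Propagators and
renormalization transformations for lattice gauge theories. II*, Commun. Math. Phys. **96** (1984) 223–250 [`Balaban1984PropagatorsII`, "[4]"],
(2.39)–(2.44) pp. 229–230, (2.51)–(2.52) p. 232.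

statement-level skeleton of published theorems with citation tags; proofs where landed; nothing here is a claim about the
Yang–Mills mass gap

THE PRINT.  (3.88) p. 409: *"Δ′_aG′₀ = I − Σ_□K(h_□)G′_□h_□ = I − R′"* with `K(h_□) = P_□∇_U + C_□`, *"where P_□, C_□ are the operators of [4] (2.39)–(2.40)"*;
[4] (2.39): *"Δ(hf) = hΔf + Σ_μ (∂_μh)(∇_μ f)(· + e_μ) + …"* — the first-order part of `K(h_□)` is a sum OVER THE DIRECTIONS μ of a coefficient
operator times the covariant difference ∇_{U,μ} of THE SAME site function.

WHY THIS FILE (cell `pub-ymgap`, Track A node N06 [B9]; node00-def-Y g20 OBS-2 «SLICE OBSTRUCTION» + memo `IDENTITIES2-DRAFT.md` (clause text and the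
stacking device adopted verbatim), dag-n06-d g10 RULING R1′; seat `pub-ymgap-dag-n06-c` g10 — the `B9Thm37Whole` lineage, 2026-08-28).
`B9Thm37Whole.Ops` carries ONE difference letter `D U : (X → ℝ) →ₗ (Y → ℝ)` and `Identities.{leibL, eq388, eq388T}` compose the coefficient letters
with it.  At the certificate's carriers `X = Y = SiteY × Fin (d+1) × κ × κ` the pinned `D` acts SLICE-WISE in the direction slot — the right letter for the
ENTRY readings (3.42)₂,₃, but then `P ∘ D` cannot express `Σ_μ P_μ∇_{U,μ}` on slice-varying inputs, so the three identities are not instantiable with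
level-uniform sizes.  The ruling: keep the carriers and every pin; move ONLY the three identities to the per-direction letters the certificate already
displays (`𝔡 : DirOps37 (𝔬 x) (Fin (d+1))`, `h𝔡d`, `h𝔡s`).  THIS FILE:
* §1 `DirLetters37 𝔬 Dir` — the per-direction coefficient letters `P U □ μ`, `PL U □ μ`, `Pt U □ μ : End X` of `K(h_□)`, of the Leibniz rule of Δ_U and of
  the transposed (3.88), WITH per-direction majorant kernels `KPd KPLd KPtd` SUMMING BELOW the `Ops` kernels `KP KPL KPt` — so `StaticOK`, `Sizes`,
  `const37` and every located numeric of the lineage stay byte-identical (def-Y's amendment: the kernel of a co-stack is the SUM of the kernels);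
* §1 ★ `Identities₂ 𝔬 𝔡 𝔩 R H U` — `Identities` with `hP hPL hPt` per direction (+ `_nonneg`, `_sum`), `leibL`, `eq388`, `eq388T` over
  `Σ_μ 𝔩.P U i μ * 𝔡.Dd U μ` ∕ `Σ_μ 𝔡.Dsd U μ * 𝔩.Pt U i μ`, and `hC hPD hCD hCL hCt hCLt leibD leibT inv` VERBATIM; `Identities₂.unchanged`;
  ★ `DirSupSq37 𝔬 𝔡 R H U` — the per-direction (3.42)₂∕₃ entries of the cube operators `G′_□` from the slice-diagonal ones (the `Gsq`-twin of n06-k's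
  `DirSup37`, inhabited at the pins by the same slice relabelling);
* §2 the STACKING DEVICE (def-Y): `stackDir T : X → X × Dir`, `costackDir S : X × Dir → X`, ★ `costackDir_comp_stackDir : costackDir S ∘ₗ stackDir T = Σ_μ S μ * T μ`,
  `hasMajorantHom_stackDir_iff`, `hasMajorantHom_costackDir` (kernel = Σ_μ of the kernels, NO `(d+1)`);
* §3 `Identities₂` READ AS THE v1 GLUE INPUTS AT `Y′ := X × Dir`: ★ `Identities₂.eq388_stacked` (= v1 `h388` with `D := stackDir 𝔡.Dd`, `P i := costackDir (𝔩.P U i)`),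
  ★ `Identities₂.leibL_stacked` (= v1 `hLeib` at `E := Lap`), ★ `Identities₂.hasMajorantHom_costackP ∕ _costackPL` (kernel `𝔬.KP i` ∕ `𝔬.KPL i`),
  ★ `DirSupSq37.hasMajorantHom_stackDd` (v1's `h342_2` at the stacked derivative) — so the LEFT Glue faces `thm37_entry1_of_342` ∕ `thm37_leftEntry_of_342`
  of `B9Thm37Glue` INSTANTIATE with no re-proof (the right face `eq388T` sums the kernels per direction inside, memo §2);
* §4 ★ `identities₂_of_identities` — v1 ⟹ v2 for a model whose direction letters resum to the one-letter products (a genuine `∇ : X → Y` serves both).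
OWNERSHIP.  Schema + device only.  The Glue v2 faces and the summation face over `Identities₂` are the engine owner's (dag-n06-k, or this seat by offer);
the instance (`𝔩` from def-Y's FILE 37 letters, memo §4 table) is node00-def-Y's FILE C-2; the edition re-typing `h36` is dag-n06-d's.  Nothing landed is edited.

HONEST SCOPE.  Records, a hypothesis schema, finite-sum linear algebra; nothing of [B9] asserted; COUNT-NEUTRAL; N06 NOT discharged; one finite lattice programme —
nothing continuum, nothing about OS positivity or the mass gap.
-/

namespace Literature.MathematicalPhysics.QuantumFieldTheory.Balaban1983to89.B9Thm37WholeDir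

open Finset B6RandomWalk B6RandomWalkHom B9Thm37Sum B9Thm34Ext B9Thm37Glue B9Thm37Whole B9RWSums346SecondDiffGp

noncomputable section

variable {g : B9.Geometry} [Fintype g.Site] {B : B9.Backgrounds} {X Y ι Dir : Type}

/-! ## §1 The direction letters, the v2 schema, the per-direction entry transfer -/

/-- **THE PER-DIRECTION COEFFICIENT LETTERS OF `K(h_□)` WITH THEIR KERNELS**: `P U □ μ` with `K(h_□) = Σ_μ P_{□,μ}∇_{U,μ} + C_□` ((3.88); [4] (2.39)–(2.40):
the coefficients `(∂_μh_□)(·)R(U_μ ·)` acting after the shift by `e_μ`), `PL U □ μ` the first-order letters of the Leibniz rule `Δ_U M_{h_□} = M_{h_□}Δ_U +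
Σ_μ PL_{□,μ}∇_{U,μ} + CL_□`, `Pt U □ μ` those of the transposed form `Σ_μ ∇*_{U,μ}Pᵗ_{□,μ} + Cᵗ_□` — all on the site lattice `X` — and per-direction
majorant kernels `KPd KPLd KPtd` (nonnegative, summing over μ below `𝔬.KP ∕ 𝔬.KPL ∕ 𝔬.KPt` — clauses of `Identities₂`).  A PARAMETER RECORD; nothing constructed.
[cite: Balaban1985BackgroundPropagators, (3.88) p.409; Balaban1984PropagatorsII, (2.39)–(2.40) pp.229–230] -/
structure DirLetters37 (𝔬 : Ops g B X Y ι) (Dir : Type) where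
  P : B.Cfg → ι → Dir → Module.End ℝ (X → ℝ)
  PL : B.Cfg → ι → Dir → Module.End ℝ (X → ℝ)
  Pt : B.Cfg → ι → Dir → Module.End ℝ (X → ℝ)
  KPd : ι → Dir → g.Site → g.Site → ℝ
  KPLd : ι → Dir → g.Site → g.Site → ℝ
  KPtd : ι → Dir → g.Site → g.Site → ℝ

/-- ★ **THE ALGEBRAIC STRUCTURE OF THE EXPANSION AT `U`, OVER THE DIRECTION LETTERS** (v2 of `B9Thm37Whole.Identities`, ruling R1′): the direction
letters are majorised per direction by nonnegative kernels summing below the `Ops` kernels (`hP hPL hPt`, `_nonneg`, `_sum`); the Leibniz rule of Δ_U through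
`M_{h_□}` reads `Δ_U M_h = M_h Δ_U + (Σ_μ PL_μ ∇_{U,μ} + CL)` (`leibL`); (3.88) *"Δ′_aG′₀ = I − Σ_□K(h_□)G′_□h_□"* with `K(h_□) = Σ_μ P_{□,μ}∇_{U,μ} + C_□` (`eq388`)
and its transpose `G′₀Δ′_a = I − Σ_□ h_□G′_□(Σ_μ ∇*_{U,μ}Pᵗ_{□,μ} + Cᵗ_□)` (`eq388T`); the remaining nine clauses of v1 (`hC hPD hCD hCL hCt hCLt leibD leibT inv`)
VERBATIM over the slice letters `𝔬.D`, `𝔬.Dstar`.  A HYPOTHESIS SCHEMA; nothing asserted.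
[cite: Balaban1985BackgroundPropagators, (3.87)–(3.88) pp.408–409 + (3.27) p.395 + (3.5)–(3.8) p.392; Balaban1984PropagatorsII, (2.39)–(2.40) pp.229–230] -/
structure Identities₂ [Fintype ι] [Fintype Dir] (𝔬 : Ops g B X Y ι) (𝔡 : DirOps37 𝔬 Dir) (𝔩 : DirLetters37 𝔬 Dir) (R : ℝ) (H : Prop)
    (U : B.Cfg) : Prop where
  hP : ∀ i μ, HasMajorant (g := toB6 g R H) 𝔬.blk (𝔩.P U i μ) (𝔩.KPd i μ)
  hPL : ∀ i μ, HasMajorant (g := toB6 g R H) 𝔬.blk (𝔩.PL U i μ) (𝔩.KPLd i μ)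
  hPt : ∀ i μ, HasMajorant (g := toB6 g R H) 𝔬.blk (𝔩.Pt U i μ) (𝔩.KPtd i μ)
  KPd_nonneg : ∀ i μ a b, 0 ≤ 𝔩.KPd i μ a b
  KPLd_nonneg : ∀ i μ a b, 0 ≤ 𝔩.KPLd i μ a b
  KPtd_nonneg : ∀ i μ a b, 0 ≤ 𝔩.KPtd i μ a b
  KPd_sum : ∀ i a b, (∑ μ, 𝔩.KPd i μ a b) ≤ 𝔬.KP i a b
  KPLd_sum : ∀ i a b, (∑ μ, 𝔩.KPLd i μ a b) ≤ 𝔬.KPL i a b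
  KPtd_sum : ∀ i a b, (∑ μ, 𝔩.KPtd i μ a b) ≤ 𝔬.KPt i a b
  hC : ∀ i, HasMajorant (g := toB6 g R H) 𝔬.blk (𝔬.Cop U i) (𝔬.KC i)
  hPD : ∀ i, HasMajorantHom (g := toB6 g R H) 𝔬.blkY 𝔬.blkY (𝔬.PD U i) (𝔬.KPD i)
  hCD : ∀ i, HasMajorantHom (g := toB6 g R H) 𝔬.blk 𝔬.blkY (𝔬.CD U i) (𝔬.KCD i)
  hCL : ∀ i, HasMajorantHom (g := toB6 g R H) 𝔬.blk 𝔬.blk (𝔬.CL U i) (𝔬.KCL i)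
  hCt : ∀ i, HasMajorant (g := toB6 g R H) 𝔬.blk (𝔬.Ct U i) (𝔬.KCt i)
  hCLt : ∀ i, HasMajorantHom (g := toB6 g R H) 𝔬.blkY 𝔬.blk (𝔬.CLt U i) (𝔬.KCLt i)
  leibD : ∀ i, 𝔬.D U ∘ₗ mulOp (𝔬.h i) = mulOp (𝔬.hY i) ∘ₗ 𝔬.D U + (𝔬.PD U i ∘ₗ 𝔬.D U + 𝔬.CD U i)
  leibT : ∀ i, mulOp (𝔬.h i) ∘ₗ 𝔬.Dstar U = 𝔬.Dstar U ∘ₗ mulOp (𝔬.hY i) + 𝔬.CLt U i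
  inv : 𝔬.Gp U * 𝔬.Δa U = 1
  leibL : ∀ i, 𝔬.Lap U ∘ₗ mulOp (𝔬.h i) = mulOp (𝔬.h i) ∘ₗ 𝔬.Lap U + ((∑ μ, 𝔩.PL U i μ * 𝔡.Dd U μ) + 𝔬.CL U i)
  eq388 : 𝔬.Δa U * (∑ i, mulOp (𝔬.h i) * 𝔬.Gsq U i * mulOp (𝔬.h i)) =
    1 - ∑ i, ((∑ μ, 𝔩.P U i μ * 𝔡.Dd U μ) + 𝔬.Cop U i) * 𝔬.Gsq U i * mulOp (𝔬.h i)
  eq388T : (∑ i, mulOp (𝔬.h i) * 𝔬.Gsq U i * mulOp (𝔬.h i)) * 𝔬.Δa U =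
    1 - ∑ i, mulOp (𝔬.h i) * 𝔬.Gsq U i * ((∑ μ, 𝔡.Dsd U μ * 𝔩.Pt U i μ) + 𝔬.Ct U i)

/-- the nine clauses that v2 keeps VERBATIM from `B9Thm37Whole.Identities`, projected as one conjunction (for engine faces that only need them).
[cite: Balaban1985BackgroundPropagators, (3.87)–(3.88) pp.408–409, bookkeeping] -/
theorem Identities₂.unchanged [Fintype ι] [Fintype Dir] {𝔬 : Ops g B X Y ι} {𝔡 : DirOps37 𝔬 Dir} {𝔩 : DirLetters37 𝔬 Dir} {R : ℝ}
    {H : Prop} {U : B.Cfg} (hi : Identities₂ 𝔬 𝔡 𝔩 R H U) :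
    (∀ i, HasMajorant (g := toB6 g R H) 𝔬.blk (𝔬.Cop U i) (𝔬.KC i)) ∧
    (∀ i, HasMajorantHom (g := toB6 g R H) 𝔬.blkY 𝔬.blkY (𝔬.PD U i) (𝔬.KPD i)) ∧
    (∀ i, HasMajorantHom (g := toB6 g R H) 𝔬.blk 𝔬.blkY (𝔬.CD U i) (𝔬.KCD i)) ∧
    (∀ i, HasMajorantHom (g := toB6 g R H) 𝔬.blk 𝔬.blk (𝔬.CL U i) (𝔬.KCL i)) ∧
    (∀ i, HasMajorant (g := toB6 g R H) 𝔬.blk (𝔬.Ct U i) (𝔬.KCt i)) ∧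
    (∀ i, HasMajorantHom (g := toB6 g R H) 𝔬.blkY 𝔬.blk (𝔬.CLt U i) (𝔬.KCLt i)) ∧
    (∀ i, 𝔬.D U ∘ₗ mulOp (𝔬.h i) = mulOp (𝔬.hY i) ∘ₗ 𝔬.D U + (𝔬.PD U i ∘ₗ 𝔬.D U + 𝔬.CD U i)) ∧
    (∀ i, mulOp (𝔬.h i) ∘ₗ 𝔬.Dstar U = 𝔬.Dstar U ∘ₗ mulOp (𝔬.hY i) + 𝔬.CLt U i) ∧
    𝔬.Gp U * 𝔬.Δa U = 1 :=
  ⟨hi.hC, hi.hPD, hi.hCD, hi.hCL, hi.hCt, hi.hCLt, hi.leibD, hi.leibT, hi.inv⟩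

/-- ★ **THE PER-DIRECTION (3.42)₂∕₃ ENTRIES OF THE CUBE OPERATORS AS A TRANSFER SCHEMA** (the `Gsq`-twin of n06-k's `DirSup37`): the slice-diagonal entry
bounds of `Local342` (`D ∘ G′_□`, `G′_□ ∘ Dstar`) give the same bound for EVERY direction letter `∇_{U,μ} ∘ G′_□`, `G′_□ ∘ ∇*_{U,μ}` — inhabited at the pins
by slice relabelling (a block of the carrier contains all slices).  A HYPOTHESIS SCHEMA; nothing asserted.
[cite: Balaban1985BackgroundPropagators, Cor. 3.6 p.408 + (3.42) p.397 + (3.5)–(3.8) p.392] -/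
structure DirSupSq37 [Fintype X] [Fintype Y] (𝔬 : Ops g B X Y ι) (𝔡 : DirOps37 𝔬 Dir) (R : ℝ) (H : Prop) (U : B.Cfg) : Prop where
  left : ∀ i (m : g.Site → g.Site → ℝ), HasMajorantHom (g := toB6 g R H) 𝔬.blk 𝔬.blkY (𝔬.D U ∘ₗ 𝔬.Gsq U i) m →
    ∀ μ : Dir, HasMajorant (g := toB6 g R H) 𝔬.blk (𝔡.Dd U μ ∘ₗ 𝔬.Gsq U i) m
  right : ∀ i (m : g.Site → g.Site → ℝ), HasMajorantHom (g := toB6 g R H) 𝔬.blkY 𝔬.blk (𝔬.Gsq U i ∘ₗ 𝔬.Dstar U) m →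
    ∀ μ : Dir, HasMajorant (g := toB6 g R H) 𝔬.blk (𝔬.Gsq U i ∘ₗ 𝔡.Dsd U μ) m

/-! ## §2 The stacking device: the direction family as ONE two-space letter over `Y′ := X × Dir` -/

/-- **STACK** a direction family of endomorphisms into one two-space letter `X → X × Dir`: `(stackDir T f)(x, μ) = (T μ f)(x)` (the gradient
`f ↦ (∇_{U,μ} f)_μ` as ONE operator into functions of `(site, direction)`). [cite: Balaban1985BackgroundPropagators, (3.3) p.390 (∇_U with its direction index), dictionary] -/
def stackDir [Fintype Dir] (T : Dir → Module.End ℝ (X → ℝ)) : (X → ℝ) →ₗ[ℝ] (X × Dir → ℝ) where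
  toFun f := fun p => T p.2 f p.1
  map_add' f f' := by funext p; simp
  map_smul' r f := by funext p; simp

/-- **CO-STACK**: sum a direction family against the direction slot, `(costackDir S F)(x) = Σ_μ (S μ F(·, μ))(x)` (the coefficient operator `P_□` of
(3.88) acting on a gradient). [cite: Balaban1985BackgroundPropagators, (3.88) p.409 («P_□∇_U»); Balaban1984PropagatorsII, (2.39) p.229] -/
def costackDir [Fintype Dir] (S : Dir → Module.End ℝ (X → ℝ)) : (X × Dir → ℝ) →ₗ[ℝ] (X → ℝ) where
  toFun F := fun x => ∑ μ, S μ (fun x' => F (x', μ)) x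
  map_add' F F' := by
    funext x
    simp only [Pi.add_apply]
    rw [← Finset.sum_add_distrib]
    refine Finset.sum_congr rfl fun μ _ => ?_
    have : (fun x' => F (x', μ) + F' (x', μ)) = (fun x' => F (x', μ)) + fun x' => F' (x', μ) := rfl
    rw [this, map_add, Pi.add_apply]
  map_smul' r F := by
    funext x
    simp only [Pi.smul_apply, smul_eq_mul, RingHom.id_apply, Finset.mul_sum]
    refine Finset.sum_congr rfl fun μ _ => ?_
    have : (fun x' => r * F (x', μ)) = r • fun x' => F (x', μ) := rfl
    rw [this, map_smul, Pi.smul_apply, smul_eq_mul]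

/-- ★ **THE CO-STACK OF `S` AFTER THE STACK OF `T` IS THE DIRECTION SUM `Σ_μ S μ * T μ`** — `P_□∇_U = Σ_μ P_{□,μ}∇_{U,μ}` as operators.
[cite: Balaban1985BackgroundPropagators, (3.88) p.409; Balaban1984PropagatorsII, (2.39) p.229] -/
theorem costackDir_comp_stackDir [Fintype Dir] (S T : Dir → Module.End ℝ (X → ℝ)) :
    costackDir S ∘ₗ stackDir T = ∑ μ, S μ * T μ := by
  apply LinearMap.ext; intro f; funext x
  simp only [LinearMap.comp_apply, LinearMap.coe_sum, Finset.sum_apply, Module.End.mul_apply]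
  rfl

/-- **the stacked letter has a two-space [4]-(2.51) majorant `m` (blocks of `X × Dir` read through `blk ∘ fst`) iff every direction has `m`**.
[cite: Balaban1984PropagatorsII, (2.51) p.232, bookkeeping] -/
theorem hasMajorantHom_stackDir_iff [Fintype Dir] (R : ℝ) (H : Prop) (blk : X → g.Site) (T : Dir → Module.End ℝ (X → ℝ))
    (m : g.Site → g.Site → ℝ) :
    HasMajorantHom (g := toB6 g R H) blk (fun p : X × Dir => blk p.1) (stackDir T) m ↔
      ∀ μ, HasMajorant (g := toB6 g R H) blk (T μ) m := by
  constructor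
  · intro h μ y' f B hf x
    exact h y' f B hf (x, μ)
  · intro h y' f B hf p
    exact h p.2 y' f B hf p.1

/-- **the co-stacked letter has the two-space majorant `Σ_μ K μ` when each `S μ` has the majorant `K μ`** — the kernel of a co-stack is the SUM of the
per-direction kernels (no factor `#Dir`). [cite: Balaban1984PropagatorsII, (2.51)–(2.52) p.232, bookkeeping] -/
theorem hasMajorantHom_costackDir [Fintype Dir] (R : ℝ) (H : Prop) (blk : X → g.Site) (S : Dir → Module.End ℝ (X → ℝ))
    (K : Dir → g.Site → g.Site → ℝ) (hS : ∀ μ, HasMajorant (g := toB6 g R H) blk (S μ) (K μ)) :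
    HasMajorantHom (g := toB6 g R H) (fun p : X × Dir => blk p.1) blk (costackDir S) (fun a b => ∑ μ, K μ a b) := by
  intro y' F B hF x
  have hμ : ∀ μ, |S μ (fun x' => F (x', μ)) x| ≤ K μ (blk x) y' * B := fun μ =>
    hS μ y' (fun x' => F (x', μ)) B ⟨hF.nonneg, fun x' hx' => hF.bound (x', μ) hx', fun x' hx' => hF.off (x', μ) hx'⟩ x
  calc |costackDir S F x| = |∑ μ, S μ (fun x' => F (x', μ)) x| := rfl
    _ ≤ ∑ μ, |S μ (fun x' => F (x', μ)) x| := Finset.abs_sum_le_sum_abs _ _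
    _ ≤ ∑ μ, K μ (blk x) y' * B := Finset.sum_le_sum fun μ _ => hμ μ
    _ = (∑ μ, K μ (blk x) y') * B := (Finset.sum_mul _ _ _).symm

/-! ## §3 `Identities₂` read as the v1 Glue inputs at `Y′ := X × Dir` (the arguments `hLeib ∕ h388 ∕ hP ∕ hPL ∕ h342_2` of `thm37_leftEntry_of_342`) -/

section Stacked

variable [Fintype ι] [Fintype Dir] {𝔬 : Ops g B X Y ι} {𝔡 : DirOps37 𝔬 Dir} {𝔩 : DirLetters37 𝔬 Dir} {R : ℝ} {H : Prop} {U : B.Cfg}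

/-- ★ **(3.88) OVER THE DIRECTION LETTERS IS THE v1 `h388`** with `D := stackDir (𝔡.Dd U)`, `P i := costackDir (𝔩.P U i)`.
[cite: Balaban1985BackgroundPropagators, (3.88) p.409] -/
theorem Identities₂.eq388_stacked (hI : Identities₂ 𝔬 𝔡 𝔩 R H U) :
    𝔬.Δa U * (∑ i, mulOp (𝔬.h i) * 𝔬.Gsq U i * mulOp (𝔬.h i)) =
      1 - ∑ i, (costackDir (𝔩.P U i) ∘ₗ stackDir (𝔡.Dd U) + 𝔬.Cop U i) * 𝔬.Gsq U i * mulOp (𝔬.h i) := by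
  simp only [costackDir_comp_stackDir]; exact hI.eq388

/-- ★ **THE LEIBNIZ RULE OF `Δ_U` OVER THE DIRECTION LETTERS IS THE v1 `hLeib` at `E := Lap`**, `PL i := costackDir (𝔩.PL U i)`.
[cite: Balaban1984PropagatorsII, (2.39)–(2.40) pp.229–230] -/
theorem Identities₂.leibL_stacked (hI : Identities₂ 𝔬 𝔡 𝔩 R H U) (i : ι) :
    𝔬.Lap U ∘ₗ mulOp (𝔬.h i) = mulOp (𝔬.h i) ∘ₗ 𝔬.Lap U + (costackDir (𝔩.PL U i) ∘ₗ stackDir (𝔡.Dd U) + 𝔬.CL U i) := by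
  rw [costackDir_comp_stackDir]; exact hI.leibL i

/-- ★ **THE STACKED `P`-LETTER HAS THE `Ops` KERNEL `KP i` AS ITS TWO-SPACE MAJORANT** (per-direction majorants + `KPd_sum`; no `#Dir`).
[cite: Balaban1984PropagatorsII, (2.39)–(2.40) pp.229–230 + (2.51) p.232] -/
theorem Identities₂.hasMajorantHom_costackP (hI : Identities₂ 𝔬 𝔡 𝔩 R H U) (i : ι) :
    HasMajorantHom (g := toB6 g R H) (fun p : X × Dir => 𝔬.blk p.1) 𝔬.blk (costackDir (𝔩.P U i)) (𝔬.KP i) :=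
  hasMajorantHom_mono (g := toB6 g R H) _ _ (hasMajorantHom_costackDir R H 𝔬.blk (𝔩.P U i) (𝔩.KPd i) (hI.hP i))
    fun a b => hI.KPd_sum i a b

/-- ★ likewise for the stacked `PL`-letter (kernel `KPL i`). [cite: Balaban1984PropagatorsII, (2.39)–(2.40) pp.229–230 + (2.51) p.232] -/
theorem Identities₂.hasMajorantHom_costackPL (hI : Identities₂ 𝔬 𝔡 𝔩 R H U) (i : ι) :
    HasMajorantHom (g := toB6 g R H) (fun p : X × Dir => 𝔬.blk p.1) 𝔬.blk (costackDir (𝔩.PL U i)) (𝔬.KPL i) :=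
  hasMajorantHom_mono (g := toB6 g R H) _ _ (hasMajorantHom_costackDir R H 𝔬.blk (𝔩.PL U i) (𝔩.KPLd i) (hI.hPL i))
    fun a b => hI.KPLd_sum i a b

/-- the stacked `Pt`-letter read the other way: each direction is majorised by `KPt i` (one term of a nonnegative sum). For the right face the kernels are
summed per direction INSIDE the face (memo §2); this is the crude per-direction bound. [cite: Balaban1984PropagatorsII, (2.39)–(2.40) pp.229–230 + (2.51) p.232] -/
theorem Identities₂.hasMajorant_Pt_le (hI : Identities₂ 𝔬 𝔡 𝔩 R H U) (i : ι) (μ : Dir) :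
    HasMajorant (g := toB6 g R H) 𝔬.blk (𝔩.Pt U i μ) (𝔬.KPt i) :=
  hasMajorant_mono (g := toB6 g R H) _ (hI.hPt i μ) fun a b =>
    (Finset.single_le_sum (fun ν _ => hI.KPtd_nonneg i ν a b) (Finset.mem_univ μ)).trans (hI.KPtd_sum i a b)

omit [Fintype ι] in
/-- ★ **v1's ENTRY INPUT `h342_2` AT THE STACKED DERIVATIVE** from the slice-diagonal entry of `Local342` and the transfer schema `DirSupSq37`.
[cite: Balaban1985BackgroundPropagators, Cor. 3.6 p.408 + (3.42) p.397] -/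
theorem DirSupSq37.hasMajorantHom_stackDd [Fintype X] [Fintype Y] (hT : DirSupSq37 𝔬 𝔡 R H U) (i : ι) (m : g.Site → g.Site → ℝ)
    (h2 : HasMajorantHom (g := toB6 g R H) 𝔬.blk 𝔬.blkY (𝔬.D U ∘ₗ 𝔬.Gsq U i) m) :
    HasMajorantHom (g := toB6 g R H) 𝔬.blk (fun p : X × Dir => 𝔬.blk p.1) (stackDir (𝔡.Dd U) ∘ₗ 𝔬.Gsq U i) m := by
  have hμ := hT.left i m h2
  intro y' f B hf p
  exact hμ p.2 y' f B hf p.1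

end Stacked

/-! ## §4 v1 ⟹ v2 when the direction letters resum to the one-letter products -/

/-- ★ **v1 ⟹ v2 FOR A MODEL WHOSE DIRECTION LETTERS RESUM TO THE ONE-LETTER PRODUCTS**: if a model carries direction letters with per-direction majorants by
nonnegative kernels summing below the `Ops` kernels and `Σ_μ P U □ μ * ∇_{U,μ} = P U □ ∘ D U`, `Σ_μ PL U □ μ * ∇_{U,μ} = PL U □ ∘ D U`,
`Σ_μ ∇*_{U,μ} * Pt U □ μ = Dstar U ∘ Pt U □` as operators on `X`, then `B9Thm37Whole.Identities` gives `Identities₂` — a model with a genuine `∇ : X → Y`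
serves both schemas. [cite: Balaban1985BackgroundPropagators, (3.88) p.409; Balaban1984PropagatorsII, (2.39)–(2.40) pp.229–230, bookkeeping] -/
theorem identities₂_of_identities [Fintype ι] [Fintype Dir] {𝔬 : Ops g B X Y ι} (𝔡 : DirOps37 𝔬 Dir) (𝔩 : DirLetters37 𝔬 Dir) {R : ℝ}
    {H : Prop} {U : B.Cfg} (hi : Identities 𝔬 R H U)
    (hP : ∀ i μ, HasMajorant (g := toB6 g R H) 𝔬.blk (𝔩.P U i μ) (𝔩.KPd i μ))
    (hPL : ∀ i μ, HasMajorant (g := toB6 g R H) 𝔬.blk (𝔩.PL U i μ) (𝔩.KPLd i μ))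
    (hPt : ∀ i μ, HasMajorant (g := toB6 g R H) 𝔬.blk (𝔩.Pt U i μ) (𝔩.KPtd i μ))
    (hKPd : ∀ i μ a b, 0 ≤ 𝔩.KPd i μ a b) (hKPLd : ∀ i μ a b, 0 ≤ 𝔩.KPLd i μ a b) (hKPtd : ∀ i μ a b, 0 ≤ 𝔩.KPtd i μ a b)
    (hsP : ∀ i a b, (∑ μ, 𝔩.KPd i μ a b) ≤ 𝔬.KP i a b) (hsPL : ∀ i a b, (∑ μ, 𝔩.KPLd i μ a b) ≤ 𝔬.KPL i a b)
    (hsPt : ∀ i a b, (∑ μ, 𝔩.KPtd i μ a b) ≤ 𝔬.KPt i a b)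
    (hsumP : ∀ i, (∑ μ, 𝔩.P U i μ * 𝔡.Dd U μ) = 𝔬.P U i ∘ₗ 𝔬.D U)
    (hsumPL : ∀ i, (∑ μ, 𝔩.PL U i μ * 𝔡.Dd U μ) = 𝔬.PL U i ∘ₗ 𝔬.D U)
    (hsumPt : ∀ i, (∑ μ, 𝔡.Dsd U μ * 𝔩.Pt U i μ) = 𝔬.Dstar U ∘ₗ 𝔬.Pt U i) :
    Identities₂ 𝔬 𝔡 𝔩 R H U where
  hP := hP
  hPL := hPL
  hPt := hPt
  KPd_nonneg := hKPd
  KPLd_nonneg := hKPLd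
  KPtd_nonneg := hKPtd
  KPd_sum := hsP
  KPLd_sum := hsPL
  KPtd_sum := hsPt
  hC := hi.hC
  hPD := hi.hPD
  hCD := hi.hCD
  hCL := hi.hCL
  hCt := hi.hCt
  hCLt := hi.hCLt
  leibD := hi.leibD
  leibT := hi.leibT
  inv := hi.inv
  leibL := fun i => by rw [hsumPL i]; exact hi.leibL i
  eq388 := by simp_rw [hsumP]; exact hi.eq388
  eq388T := by simp_rw [hsumPt]; exact hi.eq388T

end

end Literature.MathematicalPhysics.QuantumFieldTheory.Balaban1983to89.B9Thm37WholeDir
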